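import Summits.ABC.ABC.Theses.ExceptionalSetEnergy
import Literature.NumberTheory.DiophantineGeometry.AbcExceptionalSetBounds

/-!
# Crux `CountingForm` (stmt-ABC-2707) — the sector split D*, standalone (turnkey landing candidate)

`CountingForm ⟸ ProductForm ∧ PowerDeepForm`: Szpiro `6+ε` for the Frey curves of all abc triples in
counting currency (`ProductForm`: abc triples with `rad(abc) < (abc)^μ` are boundedly many for each
`μ < 1/3`) plus abc on the power-deep sector (`PowerDeepForm`: `l`-exceptional triples with
`min(a,b) ≤ c^{1-η}` are boundedly many for each `η > 0`, `l < 1`), patched by `abc > c^{3-2η}` off the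
sector (`η = (1-l)/2`, `μ = l/(2+l)`). Extracted verbatim from `Cruxes/CountingForm/SplitCensus.lean`
(§D*); see `Cruxes/CountingForm/STRATEGY-CENSUS.md` §3 D* and §7: this split passes (a)(b)(c) of the BC2
redirect exemption by the letter and FAILS (d) (its hard half `PowerDeepForm` has no plan); it was NOT
filed by the strategist. It is banked here so that, if the human rules otherwise, step 1 of the ready
command set is a namespace rename away: change the namespace below to `Summit.ABC.ABC.Theorems` and
`ledger propose --kind proof --target Summits/ABC/ABC/Theorems/ExceptionalSetEnergyCountingFormSplit.lean
--file <this> --supports stmt-ABC-2707`, then `route edit --split CountingForm --into ProductForm PowerDeepForm`.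
Prior record of the same split in abc currency: `Cruxes/CompactBalanceTransfer/StrategySplitP1.lean`
(`abc_of_freySzpiro_of_powerDeep`). `lean check`: rc 0, 0 sorries.
-/

set_option linter.dupNamespace false

open Literature.NumberTheory.DiophantineGeometry

namespace Summit.ABC.ABC.Cruxes.CountingForm.SectorSplit

open Summit.ABC.ABC.Theses.ExceptionalSetEnergy

/-- The exceptional set at level `l` up to `X` (the set counted by `abcExponentCount l X`). -/
def excSet (l : ℝ) (X : ℕ) : Set (ℕ × ℕ × ℕ) :=
  {t | IsABCTriple t.1 t.2.1 t.2.2 ∧ t.2.2 ≤ X ∧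
    ((rad t.1 t.2.1 t.2.2 : ℕ) : ℝ) < (t.2.2 : ℝ) ^ l}

theorem excSet_finite (l : ℝ) (X : ℕ) : (excSet l X).Finite := abcExponentCount_finite l X

/-- The product-exceptional set: abc triples `c ≤ X` with `rad(abc) < (abc)^μ`. -/
def prodExcSet (μ : ℝ) (X : ℕ) : Set (ℕ × ℕ × ℕ) :=
  {t | IsABCTriple t.1 t.2.1 t.2.2 ∧ t.2.2 ≤ X ∧
    ((rad t.1 t.2.1 t.2.2 : ℕ) : ℝ) < ((t.1 * t.2.1 * t.2.2 : ℕ) : ℝ) ^ μ}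

theorem prodExcSet_finite (μ : ℝ) (X : ℕ) : (prodExcSet μ X).Finite := by
  refine ((Set.finite_Iic X).prod ((Set.finite_Iic X).prod (Set.finite_Iic X))).subset ?_
  rintro ⟨a, b, c⟩ ⟨⟨ha, hb, habc, -⟩, hcX, -⟩
  simp only [Set.mem_prod, Set.mem_Iic] at *
  omega

/-- Piece 1 — Szpiro's conjecture for Frey curves, counting form. -/
def ProductForm : Prop := ∀ μ : ℝ, μ < 1 / 3 → ∃ B : ℕ, ∀ X : ℕ, (prodExcSet μ X).ncard ≤ B

/-- The power-deep-sector exceptional set. -/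
def powerDeepExcSet (η l : ℝ) (X : ℕ) : Set (ℕ × ℕ × ℕ) :=
  {t | IsABCTriple t.1 t.2.1 t.2.2 ∧ t.2.2 ≤ X ∧
    ((rad t.1 t.2.1 t.2.2 : ℕ) : ℝ) < (t.2.2 : ℝ) ^ l ∧ ((min t.1 t.2.1 : ℕ) : ℝ) ≤ (t.2.2 : ℝ) ^ (1 - η)}

theorem powerDeepExcSet_subset (η l : ℝ) (X : ℕ) : powerDeepExcSet η l X ⊆ excSet l X :=
  fun _ ht => ⟨ht.1, ht.2.1, ht.2.2.1⟩

/-- Piece 2 — abc on the power-deep sector `min(a,b) ≤ c^{1-η}`, counting form. -/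
def PowerDeepForm : Prop :=
  ∀ η : ℝ, 0 < η → ∀ l : ℝ, l < 1 → ∃ B : ℕ, ∀ X : ℕ, (powerDeepExcSet η l X).ncard ≤ B

/-- The patching inequality: off the power-deep sector, `c^{3-2η} < abc`. -/
theorem rpow_lt_prod_of_balanced {a b c : ℕ} {η : ℝ} (hc : 0 < c)
    (ha : (c : ℝ) ^ (1 - η) < a) (hb : (c : ℝ) ^ (1 - η) < b) :
    (c : ℝ) ^ (3 - 2 * η) < (a : ℝ) * b * c := by
  have hcpos : (0 : ℝ) < c := by exact_mod_cast hc
  have hsplit : (c : ℝ) ^ (3 - 2 * η) = (c : ℝ) ^ (1 - η) * (c : ℝ) ^ (1 - η) * (c : ℝ) ^ (1 : ℝ) := by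
    rw [← Real.rpow_add hcpos, ← Real.rpow_add hcpos]
    congr 1
    ring
  rw [hsplit, Real.rpow_one]
  have h0 : (0 : ℝ) ≤ (c : ℝ) ^ (1 - η) := Real.rpow_nonneg hcpos.le _
  exact mul_lt_mul_of_pos_right (mul_lt_mul'' ha hb h0 h0) hcpos

/-- The covering: with `η = (1-l)/2`, `μ = l/(2+l)`, every `l`-exceptional triple is power-deep or
`μ`-product-exceptional. -/
theorem excSet_subset_powerDeep_union_prod {l : ℝ} (hl0 : 0 < l) (X : ℕ) :
    excSet l X ⊆ powerDeepExcSet ((1 - l) / 2) l X ∪ prodExcSet (l / (2 + l)) X := by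
  rintro ⟨a, b, c⟩ ⟨ht, hcX, hrad⟩
  by_cases hmin : ((min a b : ℕ) : ℝ) ≤ (c : ℝ) ^ (1 - (1 - l) / 2)
  · exact Or.inl ⟨ht, hcX, hrad, hmin⟩
  · refine Or.inr ⟨ht, hcX, ?_⟩
    obtain ⟨ha0, hb0, habc, -⟩ := ht
    simp only at habc hrad hmin ⊢
    push Not at hmin
    have hc : 0 < c := by omega
    have hcpos : (0 : ℝ) < c := by exact_mod_cast hc
    have ha : (c : ℝ) ^ (1 - (1 - l) / 2) < a :=
      hmin.trans_le (by exact_mod_cast min_le_left a b)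
    have hb : (c : ℝ) ^ (1 - (1 - l) / 2) < b :=
      hmin.trans_le (by exact_mod_cast min_le_right a b)
    have hprod := rpow_lt_prod_of_balanced (η := (1 - l) / 2) hc ha hb
    have hμpos : 0 < l / (2 + l) := div_pos hl0 (by linarith)
    have hexp : (c : ℝ) ^ l = ((c : ℝ) ^ (3 - 2 * ((1 - l) / 2))) ^ (l / (2 + l)) := by
      rw [← Real.rpow_mul hcpos.le]
      congr 1
      field_simp
      ring
    calc ((rad a b c : ℕ) : ℝ) < (c : ℝ) ^ l := hrad
      _ = ((c : ℝ) ^ (3 - 2 * ((1 - l) / 2))) ^ (l / (2 + l)) := hexp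
      _ < ((a : ℝ) * b * c) ^ (l / (2 + l)) :=
          Real.rpow_lt_rpow (Real.rpow_nonneg hcpos.le _) hprod hμpos
      _ = ((a * b * c : ℕ) : ℝ) ^ (l / (2 + l)) := by push_cast; ring_nf

/-- **The split glue** `ProductForm → PowerDeepForm → CountingForm` (the route decl, by name). -/
theorem countingForm_of_subs (hP : ProductForm) (hU : PowerDeepForm) :
    Summit.ABC.ABC.Theses.ExceptionalSetEnergy.CountingForm := by
  intro l hl
  by_cases hl0 : l ≤ 0
  · exact ⟨0, fun X => (abcExponentCount_eq_zero_of_nonpos hl0 X).le⟩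
  push Not at hl0
  have hη : 0 < (1 - l) / 2 := by linarith
  have hμ : l / (2 + l) < 1 / 3 := by
    rw [div_lt_iff₀ (by linarith : (0 : ℝ) < 2 + l)]
    linarith
  obtain ⟨B₁, hB₁⟩ := hU _ hη l hl
  obtain ⟨B₂, hB₂⟩ := hP _ hμ
  refine ⟨B₁ + B₂, fun X => ?_⟩
  show (excSet l X).ncard ≤ B₁ + B₂
  calc (excSet l X).ncard
      ≤ (powerDeepExcSet ((1 - l) / 2) l X ∪ prodExcSet (l / (2 + l)) X).ncard :=
        Set.ncard_le_ncard (excSet_subset_powerDeep_union_prod hl0 X)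
          (((excSet_finite l X).subset (powerDeepExcSet_subset _ l X)).union (prodExcSet_finite _ X))
    _ ≤ _ := Set.ncard_union_le _ _
    _ ≤ B₁ + B₂ := Nat.add_le_add (hB₁ X) (hB₂ X)

end Summit.ABC.ABC.Cruxes.CountingForm.SectorSplit
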